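import Literature.NumberTheory.EllipticCurves.Castella2018.TamagawaQuadraticBaseChangeProofs
import Literature.NumberTheory.GaloisRepresentations.HeckeCharacterProofs
import Mathlib.NumberTheory.Padics.HeightOneSpectrum
import HarnessLib

/-!
# `ord_p ∏ c(E^{(d_K)}) = ord_p ∏ c(E)` when the non-split bad primes are `p`-TAME FOR `j` — the Tamagawa transport of the TWISTED road
# (brick E3′ of crux 19357 / 19358; LEAD g15)

Theorems only (no definition, no named fact, no `sorry`). The tree's `Castella2018.TamagawaQuadratic.padicValNat_tamagawaProduct_quadraticTwist_eq`
(`p ≥ 5`) compares the Tamagawa products of `E` and of a model `Wd` of `E^{(d_K)}` under the bad-prime hypothesis «every bad prime of `E`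
that does not split in `K` is MULTIPLICATIVE with `p ∤ v_ℓ(Δ_min)`» — the TAME road's Wan prime. On the TWISTED road (pen memo e19 v6;
19357 `three_field_road` v37) the non-split bad prime `ℓ₀` of `E` is ADDITIVE, potentially multiplicative, with Skinner–Urban's clause in the
model-free form `p ∤ v_{ℓ₀}(j)` (`TwistedWanPrime`), so that hypothesis fails AS STATED although the conclusion holds: per place, the only
input the proof uses is the `j`-criterion of `padicValNat_localTamagawaNumber_eq_zero` («every `n > 0` with `ord_v(j) = −n` is prime to
`p`»), which `E` and `Wd` share because `j(Wd) = j(E)`. This file states the comparison under exactly that hypothesis (valuation form), and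
the corollary in the `padicValRat` form the E3′ sub-row carries.

* `padicValNat_localTamagawaNumber_quadraticTwist_eq_of_jHyp` — one place at a time;
* `padicValNat_tamagawaProduct_quadraticTwist_eq_of_jHyp` — the products;
* `padicValNat_tamagawaProduct_quadraticTwist_eq_of_padicValRat`, `not_dvd_tamagawaProduct_quadraticTwist_of_padicValRat` — the same with
  the hypothesis «`ord_ℓ(j) < 0 ⟹ p ∤ ord_ℓ(j)` at every non-split bad `ℓ`» (`¬ (p : ℤ) ∣ padicValRat ℓ W.j`).

Purpose: the hypothesis `¬ p ∣ ∏ c(Wd)` of the rank-zero kernel on the twisted road (`stub_twistedWanChainR0`); on the tame road it recovers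
`not_dvd_tamagawaProduct_tameTwist`. BSD is proved for no curve by any of this.
References: [JetchevSkinnerWan2017] §7.3.1 (eq:tamK); [Castella2018] §5; [SilvermanAEC2009] VII.6.1 (Kodaira–Néron), X.5.4.
-/

set_option linter.dupNamespace false
set_option autoImplicit false

noncomputable section

open scoped Classical NumberField

open WeierstrassCurve NumberField IsDedekindDomain IsDedekindDomain.HeightOneSpectrum
  Literature.NumberTheory.EllipticCurves Literature.NumberTheory.EllipticCurves.Rank1Residual
  Literature.NumberTheory.EllipticCurves.Castella2018.TamagawaQuadratic WithZero

namespace Summit.BirchSwinnertonDyer.BirchSwinnertonDyer.Theorems.TwistedWanRoad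

/-- `ord_p` of a finite product of non-zero naturals is the sum of the `ord_p`. [folklore] -/
private theorem padicValNat_finsetProd {ι : Type*} (p : ℕ) [Fact p.Prime] (s : Finset ι)
    (f : ι → ℕ) (hf : ∀ i ∈ s, f i ≠ 0) :
    padicValNat p (∏ i ∈ s, f i) = ∑ i ∈ s, padicValNat p (f i) := by
  classical
  induction s using Finset.induction_on with
  | empty => simp
  | insert a s ha ih =>
    rw [Finset.prod_insert ha, Finset.sum_insert ha,
      padicValNat.mul (hf a (Finset.mem_insert_self a s))
        (Finset.prod_ne_zero_iff.mpr fun i hi => hf i (Finset.mem_insert_of_mem hi)),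
      ih fun i hi => hf i (Finset.mem_insert_of_mem hi)]

/-- **The `v`-adic valuation of `ℚ` is the `p`-adic one**: `v(x) = exp(−ord_p x)`, `p = natGenerator v` (the tree's bridge,
`Curve6137MuDescentSelmer`'s form at a place of `𝓞 ℚ`). [folklore] -/
private theorem valuation_eq_exp_neg_padicValRat' (v : HeightOneSpectrum (𝓞 ℚ)) {x : ℚ} (hx : x ≠ 0) :
    v.valuation ℚ x = exp (-padicValRat (Rat.HeightOneSpectrum.natGenerator v) x) := by
  haveI hp : Fact (Rat.HeightOneSpectrum.natGenerator v).Prime := ⟨Rat.HeightOneSpectrum.prime_natGenerator v⟩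
  haveI hp' : Fact (Nat.Prime ((Rat.HeightOneSpectrum.primesEquiv v : Nat.Primes) : ℕ)) :=
    ⟨(Rat.HeightOneSpectrum.primesEquiv v).2⟩
  have hequiv := Rat.HeightOneSpectrum.valuation_equiv_padicValuation v
  set n : ℤ := padicValRat (Rat.HeightOneSpectrum.natGenerator v) x with hn
  have h2x : Rat.padicValuation (Rat.HeightOneSpectrum.primesEquiv v) x = exp (-n) := by
    change Rat.padicValuation (Rat.HeightOneSpectrum.natGenerator v) x = _
    simp [Rat.padicValuation, hx, hn]
  have h2p : Rat.padicValuation (Rat.HeightOneSpectrum.primesEquiv v)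
      ((Rat.HeightOneSpectrum.natGenerator v : ℚ) ^ n) = exp (-n) := by
    change Rat.padicValuation (Rat.HeightOneSpectrum.natGenerator v) _ = _
    rw [map_zpow₀, Rat.padicValuation_self, ← exp_zsmul]
    simp
  have h1p : v.valuation ℚ ((Rat.HeightOneSpectrum.natGenerator v : ℚ) ^ n) = exp (-n) := by
    rw [map_zpow₀, Literature.NumberTheory.GaloisRepresentations.Rat.valuation_natGenerator, ← exp_zsmul]
    simp
  rw [← h1p]
  exact (hequiv.eq_iff).mpr (h2x.trans h2p.symm)

variable (W : WeierstrassCurve ℚ) [W.IsElliptic] (p : ℕ) [Fact p.Prime]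
  (K : Type) [Field K] [NumberField K] (Wd : WeierstrassCurve ℚ) [Wd.IsElliptic]

/-- **Tamagawa numbers of a quadratic twist, one rational place at a time, under the `j`-criterion** (`p ≥ 5`): if at every bad prime of
`E` that does not split in `K` every `n > 0` with `ord_v(j(E)) = −n` is prime to `p`, then `ord_p c_v(E^{(d_K)}) = ord_p c_v(E)` at every
place `v`: at a split place `d_K` is a `v`-adic square and the two curves are `ℚ_v`-isomorphic; at a non-split place both are `p`-units
(`padicValNat_localTamagawaNumber_eq_zero`, `j(Wd) = j(E)`). [cite: JetchevSkinnerWan2017, §7.3.1 (eq:tamK)] [cite: SilvermanAEC2009, Thm VII.6.1] -/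
theorem padicValNat_localTamagawaNumber_quadraticTwist_eq_of_jHyp (hp : 5 ≤ p) (h2 : Module.finrank ℚ K = 2)
    (hbadj : ∀ v : HeightOneSpectrum (𝓞 ℚ), (Rat.HeightOneSpectrum.primesEquiv v : ℕ) ∣ W.conductorNorm ℤ →
      ¬ ((Ideal.span {((Rat.HeightOneSpectrum.primesEquiv v : ℕ) : ℤ)}).primesOver (𝓞 K)).ncard = 2 →
      ∀ n : ℕ, 0 < n → v.valuation ℚ W.j = WithZero.exp (n : ℤ) → ¬ p ∣ n)
    {C : VariableChange ℚ} (hC : C • W.quadraticTwist (NumberField.discr K : ℚ) = Wd) (v : HeightOneSpectrum (𝓞 ℚ)) :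
    padicValNat p ((Wd.baseChange (v.adicCompletion ℚ)).localTamagawaNumber (v.adicCompletionIntegers ℚ)) =
      padicValNat p ((W.baseChange (v.adicCompletion ℚ)).localTamagawaNumber (v.adicCompletionIntegers ℚ)) := by
  set ℓ : ℕ := (Rat.HeightOneSpectrum.primesEquiv v : ℕ) with hℓdef
  haveI hℓ : Fact ℓ.Prime := ⟨(Rat.HeightOneSpectrum.primesEquiv v).2⟩
  have hvℓ : (Rat.HeightOneSpectrum.primesEquiv v : ℕ) = ℓ := rfl
  have hd : (NumberField.discr K : ℚ) ≠ 0 := by exact_mod_cast NumberField.discr_ne_zero K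
  -- `j(Wd) = j(W)`
  have hjd : Wd.j = W.j := by
    haveI := W.isElliptic_quadraticTwist hd
    have h0 : ∀ (X : WeierstrassCurve ℚ) [X.IsElliptic],
        X = C • W.quadraticTwist (NumberField.discr K : ℚ) → X.j = W.j := by
      rintro X _ rfl
      rw [variableChange_j, j_quadraticTwist W hd]
    exact h0 Wd hC.symm
  by_cases hs : ((Ideal.span {(ℓ : ℤ)}).primesOver (𝓞 K)).ncard = 2
  · -- split: `d_K` is a square in `ℚ_ℓ`, the curves are isomorphic over `ℚ_ℓ`
    have hsq := isSquare_padic_discr_of_splitsIn h2 hs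
    rw [localTamagawaNumber_eq_of_twist_of_isSquare W v hvℓ hd hsq Wd hC]
  · -- not split: both local Tamagawa numbers are `p`-units
    have H : ∀ n : ℕ, 0 < n → v.valuation ℚ W.j = WithZero.exp (n : ℤ) → ¬ p ∣ n := by
      by_cases hℓN : ℓ ∣ W.conductorNorm ℤ
      · exact hbadj v hℓN hs
      · have hgood : W.HasGoodReductionAt v :=
          (hasGoodReductionAtPrime_primesEquiv_iff_holds W v ℓ hvℓ).mp
            (by
              by_contra hbad'
              exact hℓN ((W.dvd_conductorNorm_iff_not_hasGoodReductionAtPrime ℓ).mpr hbad'))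
        have hj := valuation_j_le_one_of_hasGoodReductionAt W v hgood
        intro n hn hval
        exfalso
        rw [hval, ← WithZero.exp_zero, WithZero.exp_le_exp] at hj
        omega
    rw [padicValNat_localTamagawaNumber_eq_zero W v hp H,
      padicValNat_localTamagawaNumber_eq_zero Wd v hp (by rw [hjd]; exact H)]

/-- **Tamagawa numbers of a quadratic twist, `p`-adically, under the `j`-criterion (`p ≥ 5`):
`ord_p ∏_ℓ c_ℓ(E^{(d_K)}) = ord_p ∏_ℓ c_ℓ(E)`** — the generalisation of
`Castella2018.TamagawaQuadratic.padicValNat_tamagawaProduct_quadraticTwist_eq` from «non-split bad primes multiplicative with `p ∤ v(Δ_min)`» to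
«non-split bad primes `p`-tame for `j`» (additive potentially-multiplicative primes with `p ∤ v(j)` and additive potentially-good primes are
now allowed). [cite: JetchevSkinnerWan2017, §7.3.1 (eq:tamK)] [cite: SilvermanAEC2009, Thm VII.6.1] -/
theorem padicValNat_tamagawaProduct_quadraticTwist_eq_of_jHyp (hp : 5 ≤ p) (h2 : Module.finrank ℚ K = 2)
    (hbadj : ∀ v : HeightOneSpectrum (𝓞 ℚ), (Rat.HeightOneSpectrum.primesEquiv v : ℕ) ∣ W.conductorNorm ℤ →
      ¬ ((Ideal.span {((Rat.HeightOneSpectrum.primesEquiv v : ℕ) : ℤ)}).primesOver (𝓞 K)).ncard = 2 →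
      ∀ n : ℕ, 0 < n → v.valuation ℚ W.j = WithZero.exp (n : ℤ) → ¬ p ∣ n)
    (hWd : ∃ C : VariableChange ℚ, C • W.quadraticTwist (NumberField.discr K : ℚ) = Wd) :
    padicValNat p Wd.tamagawaProduct = padicValNat p W.tamagawaProduct := by
  obtain ⟨C, hC⟩ := hWd
  set cQ : HeightOneSpectrum (𝓞 ℚ) → ℕ := fun v =>
    (W.baseChange (v.adicCompletion ℚ)).localTamagawaNumber (v.adicCompletionIntegers ℚ) with hcQ
  set cD : HeightOneSpectrum (𝓞 ℚ) → ℕ := fun v =>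
    (Wd.baseChange (v.adicCompletion ℚ)).localTamagawaNumber (v.adicCompletionIntegers ℚ) with hcD
  have hfinQ : (Function.mulSupport cQ).Finite := W.mulSupport_localTamagawaNumber_finite_holds
  have hfinD : (Function.mulSupport cD).Finite := Wd.mulSupport_localTamagawaNumber_finite_holds
  set S : Finset (HeightOneSpectrum (𝓞 ℚ)) := hfinQ.toFinset ∪ hfinD.toFinset with hS
  have hsubQ : Function.mulSupport cQ ⊆ ↑S := fun v hv => by
    rw [Finset.mem_coe, hS, Finset.mem_union]; exact Or.inl (hfinQ.mem_toFinset.mpr hv)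
  have hsubD : Function.mulSupport cD ⊆ ↑S := fun v hv => by
    rw [Finset.mem_coe, hS, Finset.mem_union]; exact Or.inr (hfinD.mem_toFinset.mpr hv)
  rw [show Wd.tamagawaProduct = ∏ᶠ v, cD v from rfl, show W.tamagawaProduct = ∏ᶠ v, cQ v from rfl,
    finprod_eq_prod_of_mulSupport_subset cD hsubD, finprod_eq_prod_of_mulSupport_subset cQ hsubQ,
    padicValNat_finsetProd p S cD fun v _ => Wd.localTamagawaNumber_baseChange_ne_zero v,
    padicValNat_finsetProd p S cQ fun v _ => W.localTamagawaNumber_baseChange_ne_zero v]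
  exact Finset.sum_congr rfl fun v _ =>
    padicValNat_localTamagawaNumber_quadraticTwist_eq_of_jHyp W p K Wd hp h2 hbadj hC v

/-- **The same in the sub-row's currency**: if at every bad prime `ℓ` of `E` not split in `K`, `ord_ℓ(j) < 0 ⟹ p ∤ ord_ℓ(j)` (the model-free
Skinner–Urban clause of `TwistedWanPrime`; vacuous at a potentially-good prime), then `ord_p ∏ c(E^{(d_K)}) = ord_p ∏ c(E)` (`p ≥ 5`).
[cite: JetchevSkinnerWan2017, §7.3.1 (eq:tamK)] [cite: SilvermanAEC2009, Thm VII.6.1] -/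
theorem padicValNat_tamagawaProduct_quadraticTwist_eq_of_padicValRat (hp : 5 ≤ p) (h2 : Module.finrank ℚ K = 2)
    (hbad : ∀ (ℓ : ℕ), ℓ.Prime → ℓ ∣ W.conductorNorm ℤ → ¬ ((Ideal.span {(ℓ : ℤ)}).primesOver (𝓞 K)).ncard = 2 →
      padicValRat ℓ W.j < 0 → ¬ (p : ℤ) ∣ padicValRat ℓ W.j)
    (hWd : ∃ C : VariableChange ℚ, C • W.quadraticTwist (NumberField.discr K : ℚ) = Wd) :
    padicValNat p Wd.tamagawaProduct = padicValNat p W.tamagawaProduct := by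
  refine padicValNat_tamagawaProduct_quadraticTwist_eq_of_jHyp W p K Wd hp h2 (fun v hℓN hns n hn hval ↦ ?_) hWd
  set ℓ : ℕ := (Rat.HeightOneSpectrum.primesEquiv v : ℕ) with hℓdef
  have hℓp : ℓ.Prime := (Rat.HeightOneSpectrum.primesEquiv v).2
  have hj0 : W.j ≠ 0 := by
    intro h0
    rw [h0, map_zero] at hval
    exact WithZero.coe_ne_zero.symm hval
  have hbr := valuation_eq_exp_neg_padicValRat' v hj0
  change v.valuation ℚ W.j = exp (-padicValRat ℓ W.j) at hbr
  rw [hval, WithZero.exp_inj] at hbr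
  -- `ord_ℓ(j) = −n < 0`
  have hneg : padicValRat ℓ W.j = -(n : ℤ) := by omega
  have hlt : padicValRat ℓ W.j < 0 := by rw [hneg]; omega
  intro hpn
  exact hbad ℓ hℓp hℓN hns hlt (by rw [hneg]; exact (Int.natCast_dvd_natCast.mpr hpn).neg_right)

/-- **`p ∤ ∏ c(E) ⟹ p ∤ ∏ c(E^{(d_K)})` on the twisted road** (`p ≥ 5`), any elliptic model `Wd` of the twist.
[cite: JetchevSkinnerWan2017, §7.3.1 (eq:tamK)] [cite: SilvermanAEC2009, Thm VII.6.1] -/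
theorem not_dvd_tamagawaProduct_quadraticTwist_of_padicValRat (hp : 5 ≤ p) (h2 : Module.finrank ℚ K = 2)
    (hbad : ∀ (ℓ : ℕ), ℓ.Prime → ℓ ∣ W.conductorNorm ℤ → ¬ ((Ideal.span {(ℓ : ℤ)}).primesOver (𝓞 K)).ncard = 2 →
      padicValRat ℓ W.j < 0 → ¬ (p : ℤ) ∣ padicValRat ℓ W.j)
    (hWd : ∃ C : VariableChange ℚ, C • W.quadraticTwist (NumberField.discr K : ℚ) = Wd)
    (htam : ¬ p ∣ W.tamagawaProduct) : ¬ p ∣ Wd.tamagawaProduct := by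
  have hv := padicValNat_tamagawaProduct_quadraticTwist_eq_of_padicValRat W p K Wd hp h2 hbad hWd
  intro hdvd
  have hne : Wd.tamagawaProduct ≠ 0 := (Wd.tamagawaProduct_pos_holds).ne'
  have h1 : 1 ≤ padicValNat p Wd.tamagawaProduct :=
    (padicValNat_dvd_iff_le hne).mp (by simpa using hdvd)
  rw [hv] at h1
  have hne' : W.tamagawaProduct ≠ 0 := (W.tamagawaProduct_pos_holds).ne'
  exact htam (by simpa using (padicValNat_dvd_iff_le hne').mpr h1)

end Summit.BirchSwinnertonDyer.BirchSwinnertonDyer.Theorems.TwistedWanRoad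

end
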